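import Mathlib
import HarnessLib
import HarnessLib.Audit
import Summits.Langlands.Langlands.Theorems.RealCyclotomicDoorSplitPrelude
import Literature.NumberTheory.Automorphic.TotallyRealModularityBoxImagesProofs
import Literature.NumberTheory.Automorphic.FLSThreeFiveSwitchingProofs

/-!
# `RealCyclotomicDoorSplit` — lens-5 g31 node on CORE = `OddPrimeDoorSplit.CoreResidual`

Cell `decomp-langlands`, lens 5 («finite/base range + asymptotic regime + bridge») in RESIDUAL MODE on the
lineage REST (stmt-Langlands-26998) → REST_E → LJR → RES → (F2T ∧ R₂⁻ ∧ R_ss⁻ ∧ R_cm⁶) → CORE, where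
CORE = `Summit.Langlands.Langlands.Theorems.OddPrimeDoorSplit.CoreResidual` (g30, tree) is the set of integral
`E` (`Δ ≠ 0`) over an unanchored totally real `K₀` of degree `≥ 6`, `[ℚ(j):ℚ]` in the residual range, off the
Allen locus and off the three odd-prime doors of g30 (`OffDoors`: not FLS-generic at 3, 5, 7; not on the
Skinner–Wiles locus; not on the Pan–Zhang locus).

## The dial (a property of the FIELD `K₀`): `K₀ ∩ ℚ(ζ_p)⁺` for `p = 5, 7`

* `p = 5`: `ℚ(ζ₅)⁺ = ℚ(√5)`; "`K₀ ∩ ℚ(ζ₅) = ℚ`" ⟺ `√5 ∉ K₀` ⟺ `¬ IsSquare (5 : K₀)`.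
* `p = 7`: `ℚ(ζ₇)⁺ = ℚ(ζ₇ + ζ₇⁻¹)`, cubic; "`K₀ ∩ ℚ(ζ₇) = ℚ`" ⟺ `X³ + X² − 2X − 1` has no root in `K₀`.

## The doors it opens (PRINT, vendored in the tree as ONE named fact, closed BY NAME — no junction)

BOX13 = `Literature.NumberTheory.Automorphic.Box2022_theorem1_3` (Box 2022, Thm. 1.3; file
`Literature/NumberTheory/Automorphic/TotallyRealModularityBoxImages.lean`): a NON-modular `E` over a totally
real `K` has (i) a framing of `E[3]` in `B(3)` or `C_s⁺(3)`; (ii) if `√5 ∉ K`, a framing of `E[5]` in `B(5)`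
(= Thorne 2016, Thm. 7.6: residually dihedral automorphy lifting, induction from the REAL quadratic subfield
`K(√5)` of `K(ζ₅)`); (iii) if `K ∩ ℚ(ζ₇) = ℚ`, a framing of `E[7]` in `B(7)` or `G(e7) ⊂ C_ns⁺(7)` (index 2)
(= Kalyanswamy 2018, Thm. 1.2 + FLS 2015, Thm. 4 / Prop. 9.1 (c)).  In the tree BOX13 is moreover REDUCED to
its printed lifting inputs (`Box2022_theorem1_3_of_fourLiftingTheorems`): modulo the g30 binder
`FLS2015_theorems3_4` it costs exactly Kalyanswamy 2018 Thm. 1.2 (`Kalyanswamy2018_theorem1_2`) and Thorne 2016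
Thm. 7.5 for `ρ_{E,p}` (= the body of `Thorne2016_theorem7_5_ellipticCurve`) — `box13_of_liftingFacts` below.
Before this node no cell node and no degree-`≥ 6` statement consumed BOX13
(tree consumers: the quartic route `SqrtFiveQuarticCovers`; clause (i) in `ThreeTorsionCollapse`).

## The cut

* T5 (THORNE SECTOR, CLOSED BY NAME): `√5 ∉ K₀` and NO Borel framing of `E[5]` ⇒ modular (`thorneFiveSector_of_box13`).
* K7 (KALYANSWAMY SECTOR, CLOSED BY NAME): `ℚ(ζ₇)⁺ ⊄ K₀` and NO framing of `E[7]` in `B(7) ∪ G(e7)` ⇒ modular.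
* C3 (CLOSED from the g30 binder FLS34 alone): no framing of `E[3]` in `B(3) ∪ C_s⁺(3)` ⇒ modular.
* CORE′ = `RefinedCore` (DECLARED RESIDUAL, IDEA-NEEDED): CORE ∩ `BoxShape` (the verbatim conclusion of BOX13).
  KERNEL: `core_of_refined : BOX13 → CORE′ → CORE`; NECESSITY `refined_of_core`; EXACTNESS `core_iff_refined`.
* CELLS of CORE′ by the dial (EXACT, `refined_iff_cells`): CELL D (`DisjointFieldCell`: `√5 ∉ K₀` and
  `ℚ(ζ₇)⁺ ⊄ K₀` — the residual curve carries a `K₀`-rational `5`-isogeny AND a `B(3)`/`C_s⁺(3)` structure AND a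
  `B(7)`/`G(e7)` structure) and CELL T (`EntangledFieldCell`: `√5 ∈ K₀` or `ℚ(ζ₇)⁺ ⊆ K₀`, hence `2 ∣ [K₀:ℚ]` or
  `3 ∣ [K₀:ℚ]` — `two_dvd_or_three_dvd_of_entangled`; every `K₀` of degree prime to `6` lies in CELL D).
* FINITE RANGE of CELL D (EXACT, `disjointFieldCell_iff_levelCells`): the four level cells
  `(b3,b5,b7) = X₀(105)`, `(s3,b5,b7)`, `(b3,b5,e7)`, `(s3,b5,e7)` — 4 of the 27 FLS level curves survive.

Compositions BY NAME up to RES / LJR / REST_E / REST through the tree's `OddPrimeDoorSplit.residual_of_core`,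
`largeJResidual_of_core`, `restE_of_core`, `closes_target` (`closes_target`, `closes_byName`; with
`box13_of_liftingFacts` the print inputs beyond g30's are exactly the two lifting theorems).  No `sorry`, no new
axiom, no `instance`, no `notation`; nothing here is a route's `closes`.
-/

set_option linter.dupNamespace false
set_option linter.unusedVariables false

open scoped NumberField IntermediateField MatrixGroups Polynomial
open NumberField IsDedekindDomain Field Polynomial Literature.NumberTheory.Automorphic
open Literature.NumberTheory.GaloisRepresentations
open Summit.Langlands.Langlands.Theorems.DepthIsolationSplit (UnanchoredBox UnanchoredHighDegreeModularE
  IntegralModelTransferPointwise SatakeAvatarTwo satakeAvatarTwo_of_host)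
open Summit.Langlands.Langlands.Theorems.JDegreeFilterSplit (jInv jDeg InResidualRange LargeJResidual
  RatBaseChangeModularity SmallFieldBaseChange largeJResidual_of_restE)
open Summit.Langlands.Langlands.Theorems.DyadicDoorSplit (AllenLocus AllenDyadicCorollary DyadicDegenerateResidual
  residual_of_largeJResidual)
open Summit.Langlands.Langlands.Theorems.OddPrimeDoorSplit (Generic357 OnSWDoor OnPZDoor OffDoors CoreResidual
  SkinnerWilesDihedralDoor PanZhangSupersingularDoor residual_of_core core_of_residual largeJResidual_of_core
  restE_of_core core_of_largeJResidual core_of_restE)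

namespace Summit.Langlands.Langlands.Theorems.RealCyclotomicDoorSplit

/-! ## §4 BOX13 by name: the Box shape of a non-modular curve, the sectors closed, the finer attribution -/

/-- The Box shape of a NON-automorphic `E` over a totally real `K₀` IS the conclusion of `Box2022_theorem1_3`
(definitional unfolding only). [cite: Box2022, Thm. 1.3] -/
theorem boxShape_of_box13 (hB : Box2022_theorem1_3) (K₀ : Type) [Field K₀] [NumberField K₀] [IsTotallyReal K₀]
    (E : WeierstrassCurve (𝓞 K₀)) (hΔ : E.Δ ≠ 0) (hne : ¬ IsAutomorphicOfWeightZero E) : BoxShape K₀ E :=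
  hB K₀ E hΔ hne

/-- FINER ATTRIBUTION (tree): modulo the g30 binder FLS34 = `FLS2015_theorems3_4`, BOX13 costs exactly the two
printed lifting theorems Kalyanswamy 2018, Thm. 1.2 (NAMED fact `Kalyanswamy2018_theorem1_2`) and Thorne 2016,
Thm. 7.5 for `ρ_{E,p}` (`hT`, written out: VERBATIM the body of the named fact
`Literature.NumberTheory.Automorphic.Thorne2016_theorem7_5_ellipticCurve` of `ResiduallyDihedralAutomorphyLifting.lean`
and the `hT` binder of the tree's `Box2022_theorem1_3_of_fourLiftingTheorems`) — through that theorem and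
`FLS2015_theorems3_4_iff`.  Hence `core_of_refined (box13_of_liftingFacts h34 hKal hT)` and `closes_target … (box13_of…) …`
have as print inputs beyond g30's exactly these two lifting theorems. [cite: Box2022, Thm. 1.3 and its proof]
[cite: Kalyanswamy2018, Thm. 1.2] [cite: Thorne2016, Thm. 7.5] -/
theorem box13_of_liftingFacts (h34 : FLS2015_theorems3_4) (hKal : Kalyanswamy2018_theorem1_2)
    (hT : ∀ (F : Type) [Field F] [NumberField F] [IsTotallyReal F] (p : ℕ) [Fact p.Prime], p ≠ 2 →
      ∀ (E : WeierstrassCurve (𝓞 F)), E.Δ ≠ 0 →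
        ∀ ρ : ModPGaloisRep F (ZMod p) 2, (E.baseChange F).IsTorsionGaloisRep p ρ →
          FramedRep.IsAbsolutelyIrreducible ρ →
          ∀ (L : Type) [Field L] [Algebra F L] [IsCyclotomicExtension {p} F L],
            (∃ (k : Type) (_ : Field k) (f : ZMod p →+* k) (Q : GL (Fin 2) k),
                (∀ τ : absoluteGaloisGroup L,
                  Q * Matrix.GeneralLinearGroup.map f (FramedGaloisRep.restrictField L ρ τ) * Q⁻¹ ∈
                    Serre1972.diagonalSubgroup k) ∧
                ∃ τ : absoluteGaloisGroup L,
                  ((Q * Matrix.GeneralLinearGroup.map f (FramedGaloisRep.restrictField L ρ τ) *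
                      Q⁻¹ : GL (Fin 2) k) : Matrix (Fin 2) (Fin 2) k) 0 0 ≠
                    ((Q * Matrix.GeneralLinearGroup.map f (FramedGaloisRep.restrictField L ρ τ) *
                      Q⁻¹ : GL (Fin 2) k) : Matrix (Fin 2) (Fin 2) k) 1 1) →
            (∃ (M : Type) (_ : Field M) (_ : Algebra F M),
                Module.finrank F M = 2 ∧ IsTotallyReal M ∧ Nonempty (M →ₐ[F] L)) →
            IsAutomorphicOfWeightZero E) :
    Box2022_theorem1_3 :=
  Box2022_theorem1_3_of_fourLiftingTheorems (FLS2015_theorem3_of_theorems3_4 h34)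
    (FLS2015_theorem4_of_theorems3_4 h34) hKal hT

/-- T5 CLOSED BY NAME from BOX13 (ii) (Thorne 2016, Thm. 7.6). -/
theorem thorneFiveSector_of_box13 (hB : Box2022_theorem1_3) : ThorneFiveSector := by
  intro K₀ _ _ hK E hΔ h5 hnB
  haveI : IsTotallyReal K₀ := hK
  by_cases hmod : IsAutomorphicOfWeightZero E
  · exact (IsHilbertModular.of_isAutomorphicOfWeightZero hΔ hmod).isModularEllipticCurve
  · exact absurd ((hB K₀ E hΔ hmod).2.1 h5) hnB

/-- K7 CLOSED BY NAME from BOX13 (iii) (Kalyanswamy 2018, Thm. 1.2 + FLS 2015). -/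
theorem kalyanswamySevenSector_of_box13 (hB : Box2022_theorem1_3) : KalyanswamySevenSector := by
  intro K₀ _ _ hK E hΔ h7 hnS
  haveI : IsTotallyReal K₀ := hK
  by_cases hmod : IsAutomorphicOfWeightZero E
  · exact (IsHilbertModular.of_isAutomorphicOfWeightZero hΔ hmod).isModularEllipticCurve
  · exact absurd ((hB K₀ E hΔ hmod).2.2 h7) hnS

/-- K7 CLOSED from the two lifting facts at `7` alone (tree `Box2022.clause_seven_of_liftingTheorems`; FLS Thm. 4
from the g30 binder FLS34). -/
theorem kalyanswamySevenSector_of_liftingFacts (h34 : FLS2015_theorems3_4) (hKal : Kalyanswamy2018_theorem1_2) :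
    KalyanswamySevenSector := by
  intro K₀ _ _ hK E hΔ h7 hnS
  haveI : IsTotallyReal K₀ := hK
  by_cases hmod : IsAutomorphicOfWeightZero E
  · exact (IsHilbertModular.of_isAutomorphicOfWeightZero hΔ hmod).isModularEllipticCurve
  · exact absurd (Box2022.clause_seven_of_liftingTheorems (FLS2015_theorem4_of_theorems3_4 h34) hKal K₀ E hΔ
      hmod h7) hnS

/-- C3 CLOSED from the g30 binder FLS34 alone (tree `Box2022.clause_three`): clause (i) is not new print input. -/
theorem cartanThreeSector_of_fls34 (h34 : FLS2015_theorems3_4) : CartanThreeSector := by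
  intro K₀ _ _ hK E hΔ hnS
  haveI : IsTotallyReal K₀ := hK
  by_cases hmod : IsAutomorphicOfWeightZero E
  · exact (IsHilbertModular.of_isAutomorphicOfWeightZero hΔ hmod).isModularEllipticCurve
  · exact absurd (Box2022.clause_three (FLS2015_theorem3_of_theorems3_4 h34) K₀ E hΔ hmod) hnS

/-! ## §5 KERNEL: CORE ⟸ BOX13 ∧ CORE′; NECESSITY; EXACTNESS -/

/-- KERNEL (0 sorry): BOX13 → CORE′ → CORE.  A curve in CORE's regime is either automorphic of weight zero —
then modular by the proved bridges `IsHilbertModular.of_isAutomorphicOfWeightZero`/`.isModularEllipticCurve` — or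
NOT, and then BOX13 puts it in Box shape, where CORE′ applies. -/
theorem core_of_refined (hB : Box2022_theorem1_3) (hR : RefinedCore) : CoreResidual := by
  intro K₀ _ _ hb E hΔ hr hA hoff
  haveI : IsTotallyReal K₀ := hb.1
  by_cases hmod : IsAutomorphicOfWeightZero E
  · exact (IsHilbertModular.of_isAutomorphicOfWeightZero hΔ hmod).isModularEllipticCurve
  · exact hR K₀ hb E hΔ hr hA hoff (hB K₀ E hΔ hmod)

/-- NECESSITY: CORE ⟹ CORE′ (a sub-locus). -/
theorem refined_of_core (h : CoreResidual) : RefinedCore :=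
  fun K₀ _ _ hb E hΔ hr hA hoff _ => h K₀ hb E hΔ hr hA hoff

/-- EXACTNESS: modulo BOX13, CORE ⟺ CORE′. -/
theorem core_iff_refined (hB : Box2022_theorem1_3) : CoreResidual ↔ RefinedCore :=
  ⟨refined_of_core, core_of_refined hB⟩

/-! ## §6 EXACTNESS of the cells and of the finite range -/

/-- Distribution at `3`: Box's clause (i) ⟺ Borel framing OR `C_s⁺(3)` framing. -/
theorem borelOrSplitCartanThree_iff (K₀ : Type) [Field K₀] [NumberField K₀] (E : WeierstrassCurve (𝓞 K₀)) :
    BorelOrSplitCartanThree K₀ E ↔ BorelAt K₀ E 3 ∨ SplitCartanThree K₀ E := by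
  constructor
  · rintro ⟨ρ, hρ, hB | hC⟩
    · exact Or.inl ⟨ρ, hρ, hB⟩
    · exact Or.inr ⟨ρ, hρ, hC⟩
  · rintro (⟨ρ, hρ, hB⟩ | ⟨ρ, hρ, hC⟩)
    · exact ⟨ρ, hρ, Or.inl hB⟩
    · exact ⟨ρ, hρ, Or.inr hC⟩

/-- Distribution at `7`: Box's clause (iii) ⟺ Borel framing OR `G(e7)` framing. -/
theorem borelOrE7Seven_iff (K₀ : Type) [Field K₀] [NumberField K₀] (E : WeierstrassCurve (𝓞 K₀)) :
    BorelOrE7Seven K₀ E ↔ BorelAt K₀ E 7 ∨ E7Seven K₀ E := by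
  constructor
  · rintro ⟨ρ, hρ, hB | hC⟩
    · exact Or.inl ⟨ρ, hρ, hB⟩
    · exact Or.inr ⟨ρ, hρ, hC⟩
  · rintro (⟨ρ, hρ, hB⟩ | ⟨ρ, hρ, hC⟩)
    · exact ⟨ρ, hρ, Or.inl hB⟩
    · exact ⟨ρ, hρ, Or.inr hC⟩

/-- CORE′ ⟹ CELL D. -/
theorem disjointFieldCell_of_refined (hR : RefinedCore) : DisjointFieldCell :=
  fun K₀ _ _ hb h5 h7 E hΔ hr hA hoff h3 hB5 hS7 => hR K₀ hb E hΔ hr hA hoff ⟨h3, fun _ => hB5, fun _ => hS7⟩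

/-- CORE′ ⟹ CELL T. -/
theorem entangledFieldCell_of_refined (hR : RefinedCore) : EntangledFieldCell :=
  fun K₀ _ _ hb _ E hΔ hr hA hoff hS => hR K₀ hb E hΔ hr hA hoff hS

/-- CELL D ∧ CELL T ⟹ CORE′ (excluded middle on the dial). -/
theorem refined_of_cells (hD : DisjointFieldCell) (hT : EntangledFieldCell) : RefinedCore := by
  intro K₀ _ _ hb E hΔ hr hA hoff hS
  by_cases h5 : IsSquare (5 : K₀)
  · exact hT K₀ hb (Or.inl h5) E hΔ hr hA hoff hS
  by_cases h7 : ∃ x : K₀, x ^ 3 + x ^ 2 - 2 * x - 1 = 0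
  · exact hT K₀ hb (Or.inr h7) E hΔ hr hA hoff hS
  push Not at h7
  exact hD K₀ hb h5 h7 E hΔ hr hA hoff hS.1 (hS.2.1 h5) (hS.2.2 h7)

/-- EXACTNESS of the cells: CORE′ ⟺ CELL D ∧ CELL T. -/
theorem refined_iff_cells : RefinedCore ↔ DisjointFieldCell ∧ EntangledFieldCell :=
  ⟨fun h => ⟨disjointFieldCell_of_refined h, entangledFieldCell_of_refined h⟩, fun h => refined_of_cells h.1 h.2⟩

/-- KERNEL at cell level: BOX13 → CELL D → CELL T → CORE. -/
theorem core_of_cells (hB : Box2022_theorem1_3) (hD : DisjointFieldCell) (hT : EntangledFieldCell) : CoreResidual :=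
  core_of_refined hB (refined_of_cells hD hT)

/-- EXACTNESS of the finite range: CELL D ⟺ the four level cells `(b3|s3, b5, b7|e7)`. -/
theorem disjointFieldCell_iff_levelCells :
    DisjointFieldCell ↔ CellB3B5B7 ∧ CellS3B5B7 ∧ CellB3B5E7 ∧ CellS3B5E7 := by
  constructor
  · intro hD
    refine ⟨?_, ?_, ?_, ?_⟩
    · intro K₀ _ _ E h h3 h5 h7
      exact hD K₀ h.1 h.2.1 h.2.2.1 E h.2.2.2.1 h.2.2.2.2.1 h.2.2.2.2.2.1 h.2.2.2.2.2.2
        ((borelOrSplitCartanThree_iff K₀ E).2 (Or.inl h3)) h5 ((borelOrE7Seven_iff K₀ E).2 (Or.inl h7))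
    · intro K₀ _ _ E h h3 h5 h7
      exact hD K₀ h.1 h.2.1 h.2.2.1 E h.2.2.2.1 h.2.2.2.2.1 h.2.2.2.2.2.1 h.2.2.2.2.2.2
        ((borelOrSplitCartanThree_iff K₀ E).2 (Or.inr h3)) h5 ((borelOrE7Seven_iff K₀ E).2 (Or.inl h7))
    · intro K₀ _ _ E h h3 h5 h7
      exact hD K₀ h.1 h.2.1 h.2.2.1 E h.2.2.2.1 h.2.2.2.2.1 h.2.2.2.2.2.1 h.2.2.2.2.2.2
        ((borelOrSplitCartanThree_iff K₀ E).2 (Or.inl h3)) h5 ((borelOrE7Seven_iff K₀ E).2 (Or.inr h7))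
    · intro K₀ _ _ E h h3 h5 h7
      exact hD K₀ h.1 h.2.1 h.2.2.1 E h.2.2.2.1 h.2.2.2.2.1 h.2.2.2.2.2.1 h.2.2.2.2.2.2
        ((borelOrSplitCartanThree_iff K₀ E).2 (Or.inr h3)) h5 ((borelOrE7Seven_iff K₀ E).2 (Or.inr h7))
  · rintro ⟨hBB, hSB, hBE, hSE⟩ K₀ _ _ hb h5 h7 E hΔ hr hA hoff h3 hB5 hS7
    have h : OnDisjointCell K₀ E := ⟨hb, h5, h7, hΔ, hr, hA, hoff⟩
    rcases (borelOrSplitCartanThree_iff K₀ E).1 h3 with h3 | h3 <;>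
      rcases (borelOrE7Seven_iff K₀ E).1 hS7 with h7' | h7'
    · exact hBB K₀ E h h3 hB5 h7'
    · exact hBE K₀ E h h3 hB5 h7'
    · exact hSB K₀ E h h3 hB5 h7'
    · exact hSE K₀ E h h3 hB5 h7'

/-! ## §7 The dial and the degree `[K₀ : ℚ]`: CELL T forces `2 ∣ [K₀:ℚ]` or `3 ∣ [K₀:ℚ]` -/

/-- `√5 ∉ K` for a number field of ODD degree: a square root of `5` generates `ℚ(√5)`, of degree `2 ∣ [K:ℚ]`
(`X² − 5` is irreducible over `ℚ`, `Box2022.not_isSquare_five_iff`). [folklore] -/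
theorem not_isSquare_five_of_not_two_dvd {K : Type*} [Field K] [NumberField K]
    (hK : ¬ 2 ∣ Module.finrank ℚ K) : ¬ IsSquare (5 : K) := by
  rintro ⟨x, hx⟩
  have h5 : ¬ IsSquare (5 : ℚ) := by
    rw [show (5 : ℚ) = ((5 : ℕ) : ℚ) by norm_num, Rat.isSquare_natCast_iff]
    rintro ⟨r, hr⟩
    have hr' : r ≤ 2 := by nlinarith
    interval_cases r <;> omega
  set p : ℚ[X] := X ^ 2 - C 5 with hp
  have hirr : Irreducible p := Box2022.not_isSquare_five_iff.mp h5
  have hmonic : p.Monic := by rw [hp]; monicity!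
  have hdeg : p.natDegree = 2 := by rw [hp]; compute_degree!
  have hroot : Polynomial.aeval x p = 0 := by
    simp only [hp, map_sub, map_pow, aeval_X, map_ofNat]
    rw [hx]; ring
  have hint : IsIntegral ℚ x := ⟨p, hmonic, by rwa [← Polynomial.aeval_def]⟩
  have hmin : minpoly ℚ x = p := (minpoly.eq_of_irreducible_of_monic hirr hroot hmonic).symm
  have hfin : Module.finrank ℚ ℚ⟮x⟯ = 2 := by
    rw [IntermediateField.adjoin.finrank hint, hmin, hdeg]
  exact hK (hfin ▸ Dvd.intro _ (Module.finrank_mul_finrank ℚ ℚ⟮x⟯ K))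

/-- Every number field of degree prime to `6` is LINEARLY DISJOINT from `ℚ(ζ₅)⁺` and `ℚ(ζ₇)⁺` (tree
`Box2022.cubic7_ne_zero` for the cubic): all of CORE over such `K₀` lies in CELL D. [folklore] -/
theorem disjoint_of_coprime_six {K : Type*} [Field K] [NumberField K] (h2 : ¬ 2 ∣ Module.finrank ℚ K)
    (h3 : ¬ 3 ∣ Module.finrank ℚ K) : ¬ IsSquare (5 : K) ∧ ∀ x : K, x ^ 3 + x ^ 2 - 2 * x - 1 ≠ 0 :=
  ⟨not_isSquare_five_of_not_two_dvd h2, Box2022.cubic7_ne_zero h3⟩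

/-- CELL T only meets degrees divisible by `2` or by `3`. [folklore] -/
theorem two_dvd_or_three_dvd_of_entangled {K : Type*} [Field K] [NumberField K]
    (h : IsSquare (5 : K) ∨ ∃ x : K, x ^ 3 + x ^ 2 - 2 * x - 1 = 0) :
    2 ∣ Module.finrank ℚ K ∨ 3 ∣ Module.finrank ℚ K := by
  by_contra hc
  push Not at hc
  rcases h with h5 | ⟨x, hx⟩
  · exact not_isSquare_five_of_not_two_dvd hc.1 h5
  · exact Box2022.cubic7_ne_zero hc.2 x hx

/-- On CELL D the residual range is just `[ℚ(j):ℚ] ≥ 5` (its other branch `[ℚ(j):ℚ] = 4 ∧ √5 ∈ ℚ(j)` would put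
`√5` in `K₀`). -/
theorem five_le_jDeg_of_not_isSquare {K₀ : Type} [Field K₀] [NumberField K₀] (h5 : ¬ IsSquare (5 : K₀))
    {E : WeierstrassCurve (𝓞 K₀)} (hr : InResidualRange K₀ E) : 5 ≤ jDeg K₀ E := by
  unfold InResidualRange at hr
  rcases hr with h | ⟨-, hsq⟩
  · exact h
  · refine absurd ?_ h5
    have h' := hsq.map (algebraMap (ℚ⟮jInv K₀ E⟯) K₀)
    rwa [map_ofNat] at h'

/-! ## §8 Compositions BY NAME up to RES, LJR, REST_E and REST (stmt-Langlands-26998) -/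

/-- Up to RES (g28's `DyadicDegenerateResidual`) through the tree's `OddPrimeDoorSplit.residual_of_core`. -/
theorem residual_of_refined (h34 : FLS2015_theorems3_4) (hSW : SkinnerWilesDihedralDoor)
    (hPZ : PanZhangSupersingularDoor) (hB : Box2022_theorem1_3) (hR : RefinedCore) : DyadicDegenerateResidual :=
  residual_of_core h34 hSW hPZ (core_of_refined hB hR)

/-- Up to LJR through the tree's `OddPrimeDoorSplit.largeJResidual_of_core`. -/
theorem largeJResidual_of_refined (hADC : AllenDyadicCorollary) (h34 : FLS2015_theorems3_4)
    (hSW : SkinnerWilesDihedralDoor) (hPZ : PanZhangSupersingularDoor) (hB : Box2022_theorem1_3)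
    (hR : RefinedCore) : LargeJResidual :=
  largeJResidual_of_core hADC h34 hSW hPZ (core_of_refined hB hR)

/-- Up to REST_E through the tree's `OddPrimeDoorSplit.restE_of_core`. -/
theorem restE_of_refined (hDBC : RatBaseChangeModularity) (hNSBC : SmallFieldBaseChange)
    (hFLS : FLS2015_theorem1) (hDNS : DNS2020_theorem4) (hBox : Box2022_theorem1_1)
    (hADC : AllenDyadicCorollary) (h34 : FLS2015_theorems3_4) (hSW : SkinnerWilesDihedralDoor)
    (hPZ : PanZhangSupersingularDoor) (hB : Box2022_theorem1_3) (hR : RefinedCore) : UnanchoredHighDegreeModularE :=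
  restE_of_core hDBC hNSBC hFLS hDNS hBox hADC h34 hSW hPZ (core_of_refined hB hR)

/-- KERNEL COMPOSITION concluding REST = `TowerDoorSplit.UnanchoredHighDegreeWitnessAutomorphy`
(stmt-Langlands-26998) BY NAME, through the tree's `OddPrimeDoorSplit.closes_target` (g30's binder list with CORE
replaced by BOX13 ∧ CORE′). -/
theorem closes_target (hDBC : RatBaseChangeModularity) (hNSBC : SmallFieldBaseChange)
    (hFLS : FLS2015_theorem1) (hDNS : DNS2020_theorem4) (hBox : Box2022_theorem1_1)
    (hADC : AllenDyadicCorollary) (h34 : FLS2015_theorems3_4) (hSW : SkinnerWilesDihedralDoor)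
    (hPZ : PanZhangSupersingularDoor) (hB : Box2022_theorem1_3) (hR : RefinedCore)
    (hIMT : IntegralModelTransferPointwise)
    (hTr : Summit.Langlands.Langlands.Theses.EllipticDegreeLadder.EllipticTransportAnyBase)
    (hW : SatakeAvatarTwo)
    (h1 : Summit.Langlands.Langlands.Theses.EllipticDegreeLadder.RankOneAutomorphy) :
    Summit.Langlands.Langlands.Theses.TowerDoorSplit.UnanchoredHighDegreeWitnessAutomorphy :=
  Summit.Langlands.Langlands.Theorems.OddPrimeDoorSplit.closes_target hDBC hNSBC hFLS hDNS hBox hADC h34 hSW hPZ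
    (core_of_refined hB hR) hIMT hTr hW h1

/-- `closes_target` with W⁺ the host item `SatakeAvatarExistence` (stmt-Langlands-17415) BY NAME. -/
theorem closes_byName (hDBC : RatBaseChangeModularity) (hNSBC : SmallFieldBaseChange)
    (hFLS : FLS2015_theorem1) (hDNS : DNS2020_theorem4) (hBox : Box2022_theorem1_1)
    (hADC : AllenDyadicCorollary) (h34 : FLS2015_theorems3_4) (hSW : SkinnerWilesDihedralDoor)
    (hPZ : PanZhangSupersingularDoor) (hB : Box2022_theorem1_3) (hR : RefinedCore)
    (hIMT : IntegralModelTransferPointwise)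
    (hTr : Summit.Langlands.Langlands.Theses.EllipticDegreeLadder.EllipticTransportAnyBase)
    (hW : Summit.Langlands.Langlands.Theses.EllipticDegreeLadder.SatakeAvatarExistence)
    (h1 : Summit.Langlands.Langlands.Theses.EllipticDegreeLadder.RankOneAutomorphy) :
    Summit.Langlands.Langlands.Theses.TowerDoorSplit.UnanchoredHighDegreeWitnessAutomorphy :=
  closes_target hDBC hNSBC hFLS hDNS hBox hADC h34 hSW hPZ hB hR hIMT hTr (satakeAvatarTwo_of_host hW) h1

/-! ### Necessity from the lineage targets (the trivial direction) -/

/-- RES ⇒ CORE′. -/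
theorem refined_of_residual (h : DyadicDegenerateResidual) : RefinedCore :=
  refined_of_core (core_of_residual h)

/-- LJR ⇒ CORE′. -/
theorem refined_of_largeJResidual (h : LargeJResidual) : RefinedCore :=
  refined_of_core (core_of_largeJResidual h)

/-- REST_E ⇒ CORE′. -/
theorem refined_of_restE (h : UnanchoredHighDegreeModularE) : RefinedCore :=
  refined_of_core (core_of_restE h)

end Summit.Langlands.Langlands.Theorems.RealCyclotomicDoorSplit
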